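import Literature.MathematicalPhysics.QuantumFieldTheory.Balaban1983to89.B6KLevelCensusIndexV1

/-!
# `Balaban1983to89.B9IndexBondAtLevel` — every level that carries a fine bond carries an index bond: a LEVEL-FAITHFUL TOTAL block map
# `fine bonds → index bonds` EXISTS at every k-level V1 member (the geometric input of the (3.47) co-reading discharge)

T. Bałaban, *Propagators and renormalization transformations for lattice gauge theories. II*, Commun. Math. Phys. **96** (1984) 223–250
[`Balaban1984PropagatorsII`, "[4]"], (2.1)–(2.4) p. 224 (*"Λ_j also denotes the set of bonds with at least one end-point in Λ_j"*),
(2.45) p. 231 (𝔅 = ⋃_j Λ_j); T. Bałaban, *Propagators for lattice gauge theories in a background field*, Commun. Math. Phys. **99** (1985)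
389–434 [`Balaban1985BackgroundPropagators`], (3.41) p. 397 (the level-j weights of |·|_{(α)}).

statement-level skeleton of published theorems with citation tags; proofs where landed; nothing here is a claim about the
Yang–Mills mass gap

THE POINT.  The (3.47) co-reading `B9Ineq347CoReading.CoReadsGlob` of the row-20∕21 leaves is discharged at def-Y's bond-sector readings
(`B9Ineq347CoReadingAtLetters.coReadsGlob_zero_kernelFamilyB`) GIVEN a block map `bI : fine bonds → index bonds` that is LEVEL-FAITHFUL: the index bond
`bI x` has the level `j(x)` of the block of `x` (then the (3.41)-weight `(L^{j(x)}|c_f|⁻¹)^γ` of `x` IS the scale length of `bI x` to the power γ).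
At members with «orphan» blocks (`B9GlobReadingOrphan`) the carrier-block map is not total, but level-faithfulness asks for much less than
«β (bI x) = block of x»: only an index bond OF THE SAME LEVEL.  THIS FILE proves one always exists — ★ `exists_bondIdx_lvl_eq`: for every
fine bond `x` there is an index bond `c` with `lvl c = (blkV1 x).1.1` — and hence ★ `exists_levelFaithful`: a level-faithful total map
`bI` exists at EVERY member (by choice).  Construction ([4] (2.3) read on the tree's `domT`): let j = lev(x₋) (1 ≦ j ≦ k) and y₀ = the
j-block of x₋; then y₀ ∈ Ω_j^{(j)} (`iterBlockOf_mem_domT_iff`).  If j = k nothing is deep at the top level and the bond ⟨y₀, y₀ + e₀⟩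
is an index bond.  If j < k, y₀ is NOT deep (x₋ itself has level j < j + 1 inside the parent (j+1)-block), and so is its SIBLING y₁ =
y₀ ± e₀ inside the same parent block (it exists since L ≧ 2 and L divides the period 2L^{m+K−j}); the bond between y₀ and y₁ has an
end-point in Ω_j^{(j)} and no deep end-point, i.e. it is an index bond of level j.
* §1 lattice lemmas on one axis (`blockOf_shift_eq`, `blockOf_unshift_eq`, `exists_sibling_bond`);
* §2 ★ `exists_bondIdx_lvl_eq`, ★ `exists_levelFaithful` (generic `hN D hk`), and `exists_levelFaithful_kIdx` at a census index.

HONEST SCOPE.  Lattice combinatorics of the tree's own domain datum; nothing of [4] or [B9] asserted; count-neutral; N06 NOT discharged; nothing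
continuum, nothing about the mass gap.  Cell `pub-ymgap` (HUMAN RULING D-0062), Track A node N06 [B9], seat `pub-ymgap-dag-n06-l` (g3), 2026-08-27.
-/

namespace Literature.MathematicalPhysics.QuantumFieldTheory.Balaban1983to89.B9IndexBondAtLevel

open LatticeFieldCalculus
open B4Reflection242 (boxDom mem_boxDom blk)
open B5Eq118OneStroke (iterBlockOf iterBlockOf_zero iterBlockOf_succ)
open B6MultiLevelBoxOperator (N0 bigSide Domains)
open B6MultiLevelTorusOperator (TDomains)
open B6Geom246MultiLevelBox (bset blkOf blkOf_val)
open B6GlobalChartV1 (PV toBox toBox_apply domT blkV1 iterBlockOf_mem_domT_iff domT_Om_one)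
open B6SectAOperatorsV1 (BondIdx)
open B6Ineq2142KLevelV1 (lvl)
open B6KLevelCensusIndexV1 (KIdx)

variable {d ℓ : ℕ} {m K : ℕ} {hd : 1 ≤ d + 1} {hL : Odd (ℓ + 1) ∧ 1 < ℓ + 1}

/-! ## §1 One-axis lattice lemmas: a sibling inside the same block -/

section Axis

variable {P : Params} {j : ℕ}

/-- `x − e_μ + e_μ = x`. [folklore] -/
private theorem shift_unshift (x : Site P j) (μ : Fin P.d) : (x.unshift μ).shift μ = x := by
  funext ν
  by_cases h : ν = μ
  · subst h; simp [Site.shift, Site.unshift]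
  · simp [Site.shift, Site.unshift, Function.update_of_ne h]

/-- no wrap-around: `(a + 1).val = a.val + 1` below the period. [folklore] -/
private theorem val_add_one {n : ℕ} (a : ZMod n) (h : a.val + 1 < n) : (a + 1).val = a.val + 1 := by
  haveI : Fact (1 < n) := ⟨by omega⟩
  rw [ZMod.val_add_of_lt (by rwa [ZMod.val_one]), ZMod.val_one]

/-- no wrap-around: `(a − 1).val = a.val − 1` above `0`. [folklore] -/
private theorem val_sub_one {n : ℕ} [NeZero n] (a : ZMod n) (h : 1 ≤ a.val) : (a - 1).val = a.val - 1 := by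
  haveI : Fact (1 < n) := ⟨lt_of_le_of_lt h (ZMod.val_lt a)⟩
  rw [ZMod.val_sub (by rwa [ZMod.val_one]), ZMod.val_one]

/-- `x + e_μ` lies in the block of `x` when the label of `x` on the axis `μ` is neither the last of its L-run nor the last of the period.
[cite: Balaban1984PropagatorsII, (2.1) p.224 (blocks of side L), bookkeeping] -/
theorem blockOf_shift_eq (x : Site P j) (μ : Fin P.d) (hlt : (x μ).val + 1 < P.sitesPerDir j) (hmod : ¬ P.L ∣ (x μ).val + 1) :
    blockOf (x.shift μ) = blockOf x := by
  funext ν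
  by_cases h : ν = μ
  · subst h
    have hval : ((x.shift ν) ν).val = (x ν).val + 1 := by
      simp only [Site.shift, Function.update_self]
      exact val_add_one _ hlt
    simp only [blockOf, hval, Nat.succ_div_of_not_dvd hmod]
  · simp [blockOf, Site.shift, Function.update_of_ne h]

/-- `x − e_μ` lies in the block of `x` when the label of `x` on the axis `μ` is not the first of its L-run.
[cite: Balaban1984PropagatorsII, (2.1) p.224 (blocks of side L), bookkeeping] -/
theorem blockOf_unshift_eq (x : Site P j) (μ : Fin P.d) (h1 : 1 ≤ (x μ).val) (hmod : ¬ P.L ∣ (x μ).val) :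
    blockOf (x.unshift μ) = blockOf x := by
  funext ν
  by_cases h : ν = μ
  · subst h
    have hval : ((x.unshift ν) ν).val = (x ν).val - 1 := by
      simp only [Site.unshift, Function.update_self]
      exact val_sub_one _ h1
    have hdiv : ((x ν).val - 1) / P.L = (x ν).val / P.L := by
      have hx : (x ν).val - 1 + 1 = (x ν).val := by omega
      rw [← Nat.succ_div_of_not_dvd (by rwa [hx]), hx]
    simp only [blockOf, hval, hdiv]
  · simp [blockOf, Site.unshift, Function.update_of_ne h]

/-- **A SIBLING BOND INSIDE THE BLOCK**: for L ≧ 2 dividing the period, every site `x` is an end-point of a bond on the axis `μ` whose two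
end-points lie in the block of `x` (`x + e_μ` if `x` is not the last of its L-run, else `x − e_μ`).
[cite: Balaban1984PropagatorsII, (2.1) p.224 (blocks of side L ≥ 2), bookkeeping] -/
theorem exists_sibling_bond (x : Site P j) (μ : Fin P.d) (hL2 : 2 ≤ P.L) (hdvd : P.L ∣ P.sitesPerDir j) :
    ∃ b : PBond P j, (b.src = x ∨ b.tgt = x) ∧ blockOf b.src = blockOf x ∧ blockOf b.tgt = blockOf x := by
  haveI : NeZero (P.sitesPerDir j) := inferInstance
  by_cases h : P.L ∣ (x μ).val + 1
  · -- last of its L-run: step back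
    have hnot : ¬ P.L ∣ (x μ).val := by
      intro h'
      have : P.L ∣ 1 := (Nat.dvd_add_right h').1 h
      have := Nat.le_of_dvd one_pos this
      omega
    have h1 : 1 ≤ (x μ).val := by
      rcases Nat.eq_zero_or_pos (x μ).val with h0 | h0
      · exact absurd (by rw [h0]; exact dvd_zero _) hnot
      · exact h0
    refine ⟨⟨x.unshift μ, μ⟩, Or.inr (shift_unshift x μ), blockOf_unshift_eq x μ h1 hnot, ?_⟩
    show blockOf ((x.unshift μ).shift μ) = blockOf x
    rw [shift_unshift]
  · -- step forward stays in the L-run, and below the period (L divides the period)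
    have hlt : (x μ).val + 1 < P.sitesPerDir j := by
      have hle : (x μ).val + 1 ≤ P.sitesPerDir j := ZMod.val_lt (x μ)
      rcases hle.lt_or_eq with hlt | heq
      · exact hlt
      · exact absurd (by rw [heq]; exact hdvd) h
    exact ⟨⟨x, μ⟩, Or.inl rfl, rfl, blockOf_shift_eq x μ hlt h⟩

end Axis

/-! ## §2 Every fine bond has an index bond of its level; a level-faithful total block map exists -/

section IndexBonds

variable {Mh k R : ℕ} {P' : Fin (d + 1) → ℕ}
variable (hN : ∀ μ, N0 ℓ Mh k P' μ = (PV d ℓ m K hd hL).sitesPerDir 0) (D : TDomains d ℓ Mh k P' R) (hk : k ≤ m + K)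

/-- the level of the block of a fine bond is the level of its source site. [cite: Balaban1984PropagatorsII, (2.45) p.231, dictionary] -/
theorem blkV1_level_eq_lev (x : PBond (PV d ℓ m K hd hL) 0) : (blkV1 hN D x).1.1 = D.lev (toBox hN x.src).1 := rfl

/-- ★ **EVERY FINE BOND HAS AN INDEX BOND OF ITS LEVEL**: for the fine bond `x` with block level j there is an index bond `c` of the V1 domain datum
with `lvl c = j` — ⟨y₀, y₀ + e₀⟩ at the top level (nothing is deep there), else the sibling bond of the j-block y₀ of x₋ inside its parent block
(y₀ ∈ Ω_j^{(j)}, neither end-point deep because x₋ has level j < j + 1). [cite: Balaban1984PropagatorsII, (2.3)–(2.4) p.224 + (2.45) p.231] -/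
theorem exists_bondIdx_lvl_eq (x : PBond (PV d ℓ m K hd hL) 0) :
    ∃ c : BondIdx (domT hN D hk), lvl hN D hk c = (blkV1 hN D x).1.1 := by
  rw [blkV1_level_eq_lev]
  set j := D.lev (toBox hN x.src).1 with hjdef
  have hj1 : 1 ≤ j := D.one_le_lev _
  have hjk : j ≤ k := D.lev_le _
  set y₀ : Site (PV d ℓ m K hd hL) j := iterBlockOf j x.src with hy₀
  have hOm : y₀ ∈ (domT hN D hk).Om j := (iterBlockOf_mem_domT_iff hN D hk hj1 hjk x.src).2 le_rfl
  by_cases htop : j = k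
  · -- the top level: nothing is deep
    have hnd : ∀ y : Site (PV d ℓ m K hd hL) j, ¬ (domT hN D hk).Deep j y := fun y =>
      (domT hN D hk).not_deep_of_le (show k ≤ j by omega) y
    let b : PBond (PV d ℓ m K hd hL) j := ⟨y₀, 0⟩
    have hLam : (domT hN D hk).LamBond j b := ⟨Or.inl hOm, hnd _, hnd _⟩
    exact ⟨⟨⟨⟨j, by show j < k + 1; omega⟩, b⟩, hLam⟩, rfl⟩
  · -- below the top: the sibling bond inside the parent block
    have hjk' : j < k := lt_of_le_of_ne hjk htop
    have hL2 : 2 ≤ (PV d ℓ m K hd hL).L := by show 2 ≤ ℓ + 1; have := hL.2; omega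
    have hdvd : (PV d ℓ m K hd hL).L ∣ (PV d ℓ m K hd hL).sitesPerDir j := by
      show ℓ + 1 ∣ 2 * (ℓ + 1) ^ (m + K - j)
      exact Dvd.dvd.mul_left (dvd_pow_self _ (by omega)) 2
    obtain ⟨b, hend, hsrc, htgt⟩ := exists_sibling_bond y₀ (0 : Fin (d + 1)) hL2 hdvd
    -- the parent block of y₀ is not in Ω_{j+1}: x₋ has level j
    have hpar : blockOf y₀ ∉ (domT hN D hk).Om (j + 1) := by
      intro hmem
      have h' : iterBlockOf (j + 1) x.src ∈ (domT hN D hk).Om (j + 1) := by rwa [iterBlockOf_succ]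
      have := (iterBlockOf_mem_domT_iff hN D hk (by omega) (by omega) x.src).1 h'
      omega
    have hnds : ¬ (domT hN D hk).Deep j b.src := by
      show blockOf b.src ∉ (domT hN D hk).Om (j + 1)
      rw [hsrc]; exact hpar
    have hndt : ¬ (domT hN D hk).Deep j b.tgt := by
      show blockOf b.tgt ∉ (domT hN D hk).Om (j + 1)
      rw [htgt]; exact hpar
    have hOm' : b.src ∈ (domT hN D hk).Om j ∨ b.tgt ∈ (domT hN D hk).Om j := by
      rcases hend with h | h
      · exact Or.inl (h ▸ hOm)
      · exact Or.inr (h ▸ hOm)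
    exact ⟨⟨⟨⟨j, by show j < k + 1; omega⟩, b⟩, ⟨hOm', hnds, hndt⟩⟩, rfl⟩

/-- ★ **A LEVEL-FAITHFUL TOTAL BLOCK MAP EXISTS** (by choice): `bI : fine bonds → index bonds` with `lvl (bI x) = level of the block of x` for every
fine bond — the geometric input of `B9Ineq347CoReadingAtLetters.coReadsGlob_zero_kernelFamilyB`, available at EVERY member, orphan blocks or not.
[cite: Balaban1984PropagatorsII, (2.3)–(2.4) p.224 + (2.45) p.231; Balaban1985BackgroundPropagators, (3.41) p.397] -/
theorem exists_levelFaithful :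
    ∃ bI : PBond (PV d ℓ m K hd hL) 0 → BondIdx (domT hN D hk), ∀ x, lvl hN D hk (bI x) = (blkV1 hN D x).1.1 :=
  ⟨fun x => (exists_bondIdx_lvl_eq hN D hk x).choose, fun x => (exists_bondIdx_lvl_eq hN D hk x).choose_spec⟩

end IndexBonds

/-! ## §3 At a k-level census index -/

section Census

variable {b₀ b₁ : ℝ}

/-- **at every k-level V1 index** (hence at every member of def-Y's Stage 3′(Y)) a level-faithful total block map on the fine bonds exists.
[cite: Balaban1984PropagatorsII, (2.3)–(2.4) p.224; Balaban1985BackgroundPropagators, (3.41) p.397] -/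
theorem exists_levelFaithful_kIdx (i : KIdx d ℓ hd hL b₀ b₁) :
    ∃ bI : PBond (PV d ℓ i.m i.K hd hL) 0 → BondIdx (domT i.hN i.D i.hk), ∀ x, lvl i.hN i.D i.hk (bI x) = (blkV1 i.hN i.D x).1.1 :=
  exists_levelFaithful i.hN i.D i.hk

end Census

end Literature.MathematicalPhysics.QuantumFieldTheory.Balaban1983to89.B9IndexBondAtLevel
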